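import Summits.BirchSwinnertonDyer.BirchSwinnertonDyer.Theorems.EisensteinPrimesGrSelmerImprimitiveFiniteness
import Summits.BirchSwinnertonDyer.BirchSwinnertonDyer.Theorems.EisensteinPrimesGrSelmerQuotientTorsionFinite
import Summits.BirchSwinnertonDyer.BirchSwinnertonDyer.Theorems.EisensteinPrimesCharGrSelmerCorankGeOfFacts
import HarnessLib

/-!
# CGLS Prop. 1.2.5's MODULE clause at `S` («`𝔛_θ^S` is f.g. `Λ`-torsion with `μ = 0`») FROM the primitive
# clause at `∅` (Thm. 1.2.2 shape, strict OR unramified currency), IN THE KERNEL, at CGLS's binders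

Cell `bsd-eis` (home `run/shared/lean/pub/bsd-eis/`), width seat `bsd-line-x2-p2` g27, crux 4
`BSDpOnCellC` (stmt-BirchSwinnertonDyer-19034), line `telescope` v21 (skeleton of record 9eb63b9f…,
UNCHANGED; helper `--supports`, no stub closed). Third brick of the seat's C2 set: the two generic files
`EisensteinPrimesGrSelmerImprimitiveFiniteness` (GV 2000 Cor. (2.3), strict groups, UP direction) and
`EisensteinPrimesGrSelmerQuotientTorsionFinite` (`Q_nr[p]` finite ⇒ `Q_Gr[p]` finite; generic finitely
decomposed `S₀`) INSTANTIATED and COMPOSED at Castella–Grossi–Lee–Skinner's character-level binders — `K` imaginary quadratic, `p` odd, `κ`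
anticyclotomic with topological generator `γ`, `vbar` any place, `θ : Γ_K → GL₁(𝒪)`, `S` a finset of
places prime to `p` over rational primes SPLIT in `K` (the `S`-binder of
`prop125_characterGrSelmerDual_torsion_muZero_dim` verbatim):

* §0 **`finite_torsionBy_grSelmer_quotient_char`**: `(H¹_{𝓕_Gr^S}(K_∞, (F/𝒪)(θ))/H¹_{𝓕_Gr}(K_∞, (F/𝒪)(θ)))[p]`
  is finite (every `w ∈ S` finitely decomposed in the anticyclotomic tower — Brink 2007 Thm. 2, via x2-p2
  g9's `CharGrSelmerCorankGeOfFacts.exists_mem_decomp_apply_ne_one_of_ncard_primesOver_under`).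
* §1 **`grDual_moduleFinite_isTorsion_muZero_of_grDual_primitive`**: if SOME strict dual datum of the
  primitive group `H¹_{𝓕_Gr}(K_∞, (F/𝒪)(θ))` is f.g. `Λ`-torsion with `μ = 0`, then EVERY strict dual datum
  of `H¹_{𝓕_Gr^S}(K_∞, (F/𝒪)(θ))` is f.g. `Λ`-torsion with `μ = 0`.
* §2 **`grDual_moduleFinite_isTorsion_muZero_of_unrDual_primitive`**: the same FROM the UNRAMIFIED
  primitive duals (`GreenbergVatsal2000.DatumDualData … (bdpData …) ∅` — the currency in which the tree's
  character main-conjecture engines `IwasawaTwoVariable.charMainConj_muLambda_free_of_facts` /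
  `ResidualPairMuLambdaOfPub.omegaSide_of_pub` conclude), for a Teichmüller-valued `θ` with `D_v̄` NOT
  fixing `(F/𝒪)(θ)[p]` pointwise («`θ|_{G_v̄} ≠ 𝟙`», prop125's own binder): x2-p2 g8/g9's UNCONDITIONAL
  bridge `StrictEqUnramifiedCentral.grSelmer_charModule_eq_unrSelmer` + transfer
  `prop_grDualData_of_forall_datumDualData`, then §1.

In CGLS's printed proof of Prop. 1.2.5 this is exactly «By Thm. 1.2.2 [Rubin, Hida] `𝔛_θ` is `Λ`-torsion with
`μ = 0` … (eq:sur2) … therefore `𝔛_θ^S` is `Λ`-torsion with `μ(𝔛_θ^S) = μ(𝔛_θ) = 0`», with Thm. 1.2.2's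
conclusion kept as the HYPOTHESIS `hprim`. WHY (C2 programme, evidence #56 on -19034, host conditions STATUS
l.7341): the (f.g., torsion, `μ = 0`) triple of Prop. 1.2.5 that crux 4's consumers destructure at `S`
becomes a kernel consequence of the primitive triple, which the tree derives for the base-change
Teichmüller characters from BCGKPST Thm. 3.3.1 / de Shalit II.6.4 / Hida Thm. I (names already on the line's
list). NOT HERE (honest): Prop. 1.2.5's DIMENSION clause `#H¹_{𝓕_Gr^S}[p] = p^λ` (consumed in the cone by
`ResidualDevissageNonsplitLambdaIdentityOfFacts.lambdaInvariant_le_add_of_prop125_of_cor126` for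
ℤ_p-freeness) is untouched; nothing is «redundant» yet; 27 names by name of record.

HONEST FRAMING: theorems only (no definition, no named fact, no `sorry`, no instance); closes no stub,
discharges no Literature fact, moves no count; BSD is proved for no curve.

References: CGLS 2022 §1.2 Thm. 1.2.2, Prop. 1.2.5 and proof (arXiv:2008.02571 Thm. 11, Prop. 14);
Greenberg–Vatsal 2000 §2 Cor. (2.3); Keller–Yin 2024 Rem. 1.2.3 (i), Prop. 1.2.5; Brink 2007 Thm. 2.
-/

set_option linter.dupNamespace false
set_option autoImplicit false

noncomputable section

open scoped Classical AddSubgroup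

open NumberField IsDedekindDomain Field
open Literature.NumberTheory.EllipticCurves Literature.NumberTheory.EllipticCurves.GreenbergSelmer
  Literature.NumberTheory.EllipticCurves.GreenbergVatsal2000
  Literature.NumberTheory.EllipticCurves.KellerYin2024
  Literature.NumberTheory.GaloisRepresentations
open Summit.BirchSwinnertonDyer.BirchSwinnertonDyer.Theorems

namespace Summit.BirchSwinnertonDyer.BirchSwinnertonDyer.Theorems.GrDualImprimitiveOfPrimitiveChar

variable {K : Type} [Field K] [NumberField K] {p : ℕ} [hp : Fact p.Prime]

/-! ## §0 `(H¹_{𝓕_Gr^S}/H¹_{𝓕_Gr})[p]` is finite for `(F/𝒪)(θ)` at split `S` -/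

/-- **`(H¹_{𝓕_Gr^S}(K_∞, (F/𝒪)(θ)) / H¹_{𝓕_Gr}(K_∞, (F/𝒪)(θ)))[p]` is FINITE at CGLS's binders**: `K`
imaginary quadratic, `p` odd, `κ` anticyclotomic with topological generator `γ`, any `vbar`, any
character `θ : Γ_K → GL₁(𝒪)`, and `S` a finset of places prime to `p` over rational primes SPLIT in `K`
(the `S`-binder of `prop125_characterGrSelmerDual_torsion_muZero_dim` verbatim): the generic strict theorem at the character
module (`p`-divisible, `#(·)[p] = p`, open stabilisers — `UnrSelmerQuotientTorsionFiniteChar` §1;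
`GrSelmerQuotientTorsionFinite.finite_torsionBy_grSelmer_quotient`) with
every `w ∈ S` finitely decomposed (Brink 2007 Thm. 2 at a degree-one place: x2-p2 g9's
`CharGrSelmerCorankGeOfFacts.exists_mem_decomp_apply_ne_one_of_ncard_primesOver_under`). The local half of CGLS
Prop. 1.2.5's (eq:sur2) «`… → ∏_{w∈S} H¹(K_w, M_θ)`, `Λ`-cotorsion factors» IN THE KERNEL, strict currency.
[cite: CastellaGrossiLeeSkinner2022, §1.2 Prop. 1.2.5 proof (eq:sur2) (arXiv:2008.02571 Prop. 14)]
[cite: GreenbergVatsal2000, §2 pp. 20–21] [cite: Brink2007, Thm. 2] -/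
theorem finite_torsionBy_grSelmer_quotient_char (hK : IsImaginaryQuadratic K) (hp2 : p ≠ 2)
    (κ : ZpExtension K p) (hκ : κ.IsAnticyclotomic) {γ : absoluteGaloisGroup K}
    (hγ : κ.IsTopGenerator γ) (vbar : HeightOneSpectrum (𝓞 K))
    (θ : FramedGaloisRep K (padicCoeffIntegers (∅ : Set (PadicAlgCl p))) 1)
    (S : Finset (HeightOneSpectrum (𝓞 K)))
    (hSmem : ∀ v ∈ S, ((p : ℕ) : 𝓞 K) ∉ v.asIdeal ∧
      ((v.asIdeal.under ℤ).primesOver (𝓞 K)).ncard = 2) :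
    Finite ((↥(grSelmer κ (charModule (∅ : Set (PadicAlgCl p)) θ) vbar
        (↑S : Set (HeightOneSpectrum (𝓞 K)))) ⧸
      (grSelmer κ (charModule (∅ : Set (PadicAlgCl p)) θ) vbar
          (∅ : Set (HeightOneSpectrum (𝓞 K)))).addSubgroupOf
        (grSelmer κ (charModule (∅ : Set (PadicAlgCl p)) θ) vbar
          (↑S : Set (HeightOneSpectrum (𝓞 K)))))[(p : ℤ)]) := by
  haveI := IwasawaTwoVariable.finite_torsionBy_charModule θ
  exact GrSelmerQuotientTorsionFinite.finite_torsionBy_grSelmer_quotient κ vbar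
    (M := charModule (∅ : Set (PadicAlgCl p)) θ)
    ⟨1, by rw [UnrSelmerQuotientTorsionFiniteChar.natCard_torsionBy_charModule, pow_one]⟩
    (UnrSelmerQuotientTorsionFiniteChar.exists_nsmul_eq_charModule θ)
    (isOpen_stabilizer_cofree (∅ : Set (PadicAlgCl p)) θ) hγ S
    (fun w hw hpw ↦ CharGrSelmerCorankGeOfFacts.exists_mem_decomp_apply_ne_one_of_ncard_primesOver_under hK
      hp2 κ hκ w hpw (hSmem w hw).2)


/-! ## §1 Strict primitive ⇒ strict `S`-imprimitive -/

/-- **`𝔛_θ` f.g. `Λ`-torsion `μ = 0` (SOME strict dual datum at `∅`) ⇒ `𝔛_θ^S` f.g. `Λ`-torsion `μ = 0`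
(EVERY strict dual datum at `S`)** at CGLS's binders (`K` imaginary quadratic, `p` odd, `κ` anticyclotomic,
`γ` a topological generator, any `vbar`, any `θ : Γ_K → GL₁(𝒪)`, `S` prime to `p` over primes split in
`K`): `GrSelmerImprimitiveFiniteness.moduleFinite_isTorsion_muZero_of_primitive` fed
`finite_torsionBy_grSelmer_quotient_char` (§0). CGLS Prop. 1.2.5, proof:
«therefore `𝔛_θ^S` is `Λ`-torsion with `μ(𝔛_θ^S) = μ(𝔛_θ) = 0`».
[cite: CastellaGrossiLeeSkinner2022, §1.2 Prop. 1.2.5 and proof (eq:sur2) (arXiv:2008.02571 Prop. 14; Invent. Math. 227 (2022) 517–580)]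
[cite: GreenbergVatsal2000, §2 Cor. (2.3) (arXiv:math/9906215 pp. 20–21)] -/
theorem grDual_moduleFinite_isTorsion_muZero_of_grDual_primitive (hK : IsImaginaryQuadratic K)
    (hp2 : p ≠ 2) (κ : ZpExtension K p) (hκ : κ.IsAnticyclotomic) {γ : absoluteGaloisGroup K}
    (hγ : κ.IsTopGenerator γ) (vbar : HeightOneSpectrum (𝓞 K))
    (θ : FramedGaloisRep K (padicCoeffIntegers (∅ : Set (PadicAlgCl p))) 1)
    (S : Finset (HeightOneSpectrum (𝓞 K)))
    (hSmem : ∀ v ∈ S, ((p : ℕ) : 𝓞 K) ∉ v.asIdeal ∧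
      ((v.asIdeal.under ℤ).primesOver (𝓞 K)).ncard = 2)
    (G₀ : GrDualData κ (charModule (∅ : Set (PadicAlgCl p)) θ) vbar (∅ : Set (HeightOneSpectrum (𝓞 K))) γ)
    [Module.Finite (IwasawaAlgebra p) G₀.X] (hT₀ : Module.IsTorsion (IwasawaAlgebra p) G₀.X)
    (hμ₀ : muInvariant p G₀.X = 0)
    (G : GrDualData κ (charModule (∅ : Set (PadicAlgCl p)) θ) vbar (↑S : Set (HeightOneSpectrum (𝓞 K))) γ) :
    Module.Finite (IwasawaAlgebra p) G.X ∧ Module.IsTorsion (IwasawaAlgebra p) G.X ∧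
      muInvariant p G.X = 0 :=
  GrSelmerImprimitiveFiniteness.moduleFinite_isTorsion_muZero_of_primitive κ vbar
    (exists_pow_smul_cofree_eq_zero (∅ : Set (PadicAlgCl p)) θ)
    (isOpen_stabilizer_cofree (∅ : Set (PadicAlgCl p)) θ) hγ
    (Set.empty_subset (↑S : Set (HeightOneSpectrum (𝓞 K)))) G₀ hT₀ hμ₀
    (finite_torsionBy_grSelmer_quotient_char hK hp2 κ hκ hγ vbar θ S hSmem) G

/-! ## §2 Unramified primitive (the engines' currency) ⇒ strict `S`-imprimitive, for `θ|_{G_v̄} ≠ 𝟙` -/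

/-- **Every UNRAMIFIED primitive dual `H¹_{𝓕_nr}(K_∞, (F/𝒪)(θ))^∨` f.g. `Λ`-torsion `μ = 0` ⇒ every STRICT
`S`-imprimitive dual `𝔛_θ^S` f.g. `Λ`-torsion `μ = 0`**, at CGLS's binders and for a Teichmüller-valued `θ`
(`θ(σ)^{p−1} = 1`) with `D_v̄` not fixing `(F/𝒪)(θ)[p]` pointwise («`θ|_{G_v̄} ≠ 𝟙`»): the unconditional
bridge `H¹_{𝓕_Gr} = H¹_{𝓕_nr}` (`StrictEqUnramifiedCentral.grSelmer_charModule_eq_unrSelmer`; CGLS, proof of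
Thm. 1.2.2: «the Selmer group `H¹_{F_Gr}(K, M_θ)` is the same as the one defined by the unramified local
conditions») transfers `hprim` to a strict primitive datum (`prop_grDualData_of_forall_datumDualData`),
then §1. The (f.g., torsion, `μ = 0`) triple of CGLS Prop. 1.2.5 at `S` from Thm. 1.2.2's conclusion at `∅`.
[cite: CastellaGrossiLeeSkinner2022, §1.2 Thm. 1.2.2 and proof, Prop. 1.2.5 and proof (arXiv:2008.02571 Thm. 11, Prop. 14)]
[cite: KellerYin2024, Rem. 1.2.3 (i) (arXiv:2402.12781v2)] [cite: GreenbergVatsal2000, §2 Cor. (2.3)] -/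
theorem grDual_moduleFinite_isTorsion_muZero_of_unrDual_primitive (hK : IsImaginaryQuadratic K)
    (hp2 : p ≠ 2) (κ : ZpExtension K p) (hκ : κ.IsAnticyclotomic) {γ : absoluteGaloisGroup K}
    (hγ : κ.IsTopGenerator γ) (vbar : HeightOneSpectrum (𝓞 K))
    (θ : FramedGaloisRep K (padicCoeffIntegers (∅ : Set (PadicAlgCl p))) 1)
    (hθ : ∀ σ : absoluteGaloisGroup K, θ σ ^ (p - 1) = 1)
    (hne1 : ¬ ∀ g ∈ decomp vbar, ∀ m : charModule (∅ : Set (PadicAlgCl p)) θ, p • m = 0 → g • m = m)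
    (S : Finset (HeightOneSpectrum (𝓞 K)))
    (hSmem : ∀ v ∈ S, ((p : ℕ) : 𝓞 K) ∉ v.asIdeal ∧
      ((v.asIdeal.under ℤ).primesOver (𝓞 K)).ncard = 2)
    (hprim : ∀ D : DatumDualData κ γ (charModule (∅ : Set (PadicAlgCl p)) θ)
      (Castella2018.AcSelmer.bdpData (charModule (∅ : Set (PadicAlgCl p)) θ) p vbar)
      (∅ : Set (HeightOneSpectrum (𝓞 K))),
      Module.Finite (IwasawaAlgebra p) D.X ∧ Module.IsTorsion (IwasawaAlgebra p) D.X ∧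
        muInvariant p D.X = 0)
    (G : GrDualData κ (charModule (∅ : Set (PadicAlgCl p)) θ) vbar (↑S : Set (HeightOneSpectrum (𝓞 K))) γ) :
    Module.Finite (IwasawaAlgebra p) G.X ∧ Module.IsTorsion (IwasawaAlgebra p) G.X ∧
      muInvariant p G.X = 0 := by
  obtain ⟨G₀⟩ := nonempty_grDualData_char (∅ : Set (PadicAlgCl p)) θ κ vbar
    (∅ : Set (HeightOneSpectrum (𝓞 K))) hγ
  have hbridge := StrictEqUnramifiedCentral.grSelmer_charModule_eq_unrSelmer κ vbar
    (∅ : Set (HeightOneSpectrum (𝓞 K))) θ hθ hne1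
  obtain ⟨hfg₀, hT₀, hμ₀⟩ := StrictEqUnramifiedCentral.prop_grDualData_of_forall_datumDualData κ vbar
    (∅ : Set (HeightOneSpectrum (𝓞 K))) hbridge
    (fun X _ _ ↦ Module.Finite (IwasawaAlgebra p) X ∧ Module.IsTorsion (IwasawaAlgebra p) X ∧
      muInvariant p X = 0) hprim G₀
  haveI := hfg₀
  exact grDual_moduleFinite_isTorsion_muZero_of_grDual_primitive hK hp2 κ hκ hγ vbar θ S hSmem G₀ hT₀ hμ₀ G

end Summit.BirchSwinnertonDyer.BirchSwinnertonDyer.Theorems.GrDualImprimitiveOfPrimitiveChar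

end
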